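import Mathlib
import Literature.Probability.PointProcesses.LensConsistentLaw
import Literature.MathematicalPhysics.StatisticalMechanics.LennardJonesClusters
import Literature.MathematicalPhysics.StatisticalMechanics.BarlowStacking
import Literature.Probability.Process.RootedHardCoreVague
import Literature.Probability.Process.PointStationaryLaw
import Summits.AtomisticToContinuum.Crystallization.Theorems.FrustrationRangeCertificatesPatternPricedCertificatesStubLevelLift
import Summits.AtomisticToContinuum.Crystallization.Theorems.PalmUnimodularRigidityBenjaminiSchrammLimitEnergy
import HarnessLib

/-!
# Crux `PatternPricedCertificates` (stmt-AtomisticToContinuum-12974), line `registered`: stub `stub_lawEnergy`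

The law representing a minimal-energy mean family has mean root energy `≤ e⋆`. Bridge stub B3 of the line.
-/

noncomputable section

open scoped BigOperators Classical
open MeasureTheory

namespace Summit.AtomisticToContinuum.Crystallization.Theorems.PatternPricedCertificates

open Literature.Probability.PointProcesses (IsRootedPattern ballPattern)
open Literature.MathematicalPhysics.StatisticalMechanics (lennardJones lennardJones_nonpos
  lennardJones_zero PeriodicConfiguration)
open Literature.Probability.Process (LocalConfig)
open Literature.Probability.Process.LocalConfig (RootedHardCoreConfig toMeasure toMeasure_def
  integral_count_restrict_finset)
open Summit.AtomisticToContinuum.Crystallization.Theorems.BenjaminiSchrammLimit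
  (continuous_integral_lennardJones_toMeasure)

/-- On a rooted hard-core configuration with finite carrier `insert 0 ↑T` the root energy
`∫ V_LJ ‖y‖ d(count|S)` is the one-centre sum `Σ_{v ∈ T} V_LJ ‖v‖` (`V_LJ 0 = 0`). [folklore] -/
theorem lawEnergy_integral_eq_sum {δ : ℝ} (S : RootedHardCoreConfig (EuclideanSpace ℝ (Fin 3)) δ)
    (T : Finset (EuclideanSpace ℝ (Fin 3)))
    (hS : ((S.1 : LocalConfig (EuclideanSpace ℝ (Fin 3))) : Set (EuclideanSpace ℝ (Fin 3))) =
      insert (0 : EuclideanSpace ℝ (Fin 3)) (↑T : Set (EuclideanSpace ℝ (Fin 3)))) :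
    ∫ y, lennardJones ‖y‖ ∂(toMeasure S.1) = ∑ v ∈ T, lennardJones ‖v‖ := by
  rw [toMeasure_def, hS, ← Finset.coe_insert, integral_count_restrict_finset,
    Finset.sum_insert_zero (by rw [norm_zero, lennardJones_zero])]

/-- Truncating the one-centre sum at a radius `ρ ≥ 1` can only increase it (`V_LJ ≤ 0` beyond
`1`). [folklore] -/
theorem lawEnergy_sum_le_sum_ballPattern {ρ : ℝ} (hρ : 1 ≤ ρ)
    (T : Finset (EuclideanSpace ℝ (Fin 3))) :
    ∑ v ∈ T, lennardJones ‖v‖ ≤ ∑ v ∈ ballPattern ρ T, lennardJones ‖v‖ := by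
  refine Finset.sum_le_sum_of_subset_of_nonpos' (Finset.filter_subset _ T) fun v hv hv' => ?_
  refine lennardJones_nonpos (hρ.trans (le_of_lt (not_le.1 fun h => hv' ?_)))
  exact Finset.mem_filter.2 ⟨hv, h⟩

/-- **Monotonicity in the level.** For a mean `m` at level `(δ, L)` (additive, homogeneous,
nonnegative on functionals valued in `[0, 1]` on admissible patterns) and `1 ≤ ρ`, the mean of any
functional agreeing on admissible patterns with the one-centre sum is at most the mean of the
`ρ`-truncated one-centre sum. [folklore] -/
theorem lawEnergy_mean_le_mean_ballPattern {δ L ρ : ℝ} (hδ : 0 < δ) (hρ : 1 ≤ ρ)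
    {m : (Finset (EuclideanSpace ℝ (Fin 3)) → ℝ) → ℝ}
    (hadd : ∀ f₁ f₂ : Finset (EuclideanSpace ℝ (Fin 3)) → ℝ, m (f₁ + f₂) = m f₁ + m f₂)
    (hsmul : ∀ (t : ℝ) (f : Finset (EuclideanSpace ℝ (Fin 3)) → ℝ), m (t • f) = t * m f)
    (hpos : ∀ f : Finset (EuclideanSpace ℝ (Fin 3)) → ℝ,
      (∀ S, IsRootedPattern δ L S → 0 ≤ f S ∧ f S ≤ 1) → 0 ≤ m f)
    {f : Finset (EuclideanSpace ℝ (Fin 3)) → ℝ}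
    (hf : ∀ T, IsRootedPattern δ L T → f T = ∑ v ∈ T, lennardJones ‖v‖) :
    m f ≤ m (fun T => ∑ v ∈ ballPattern ρ T, lennardJones ‖v‖) := by
  obtain ⟨M₁, hM₁⟩ := levelLift_abs_sum_le hδ L
  obtain ⟨M₂, hM₂⟩ := levelLift_abs_sum_le hδ ρ
  refine levelLift_mean_mono (Ω := IsRootedPattern δ L) hadd hsmul hpos (M := |M₁| + |M₂| + 1)
    (by positivity) (fun T hT => ?_) (fun T hT => ?_)
  · rw [hf T hT]
    exact lawEnergy_sum_le_sum_ballPattern hρ T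
  · rw [hf T hT]
    have h1 := abs_le.1 (hM₁ T hT)
    have h2 := abs_le.1 (hM₂ _ (levelLift_isRootedPattern_ballPattern ρ hT))
    linarith [h1.1, h2.2, le_abs_self M₁, le_abs_self M₂]

/-- **Stub B3 (the represented law has mean root energy `≤ e⋆`).** If the mean family has minimal energy
(`∀ η > 0 ∃ ρ ≥ 1, ℓ ρ (½h_ρ) ≤ e⋆ + η`), then `∫ (∫ V_LJ ‖y‖ d count|S)/2 dQ ≤ e⋆` for the representing law `Q`: the root
energy `S ↦ ∫ V_LJ ‖y‖ d count|S` is continuous (`continuous_integral_lennardJones_toMeasure`), on `ι T` it is the full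
one-centre sum `Σ_{v ∈ T} V_LJ ‖v‖` (`V_LJ 0 = 0`), and `n ↦ ℓ n` of it is non-increasing for `n ≥ 1` (`V_LJ ≤ 0` beyond
`1`, projectivity, monotonicity of means). [folklore] -/
theorem stub_lawEnergy :
    ∀ δ : ℝ, 0 < δ → ∀ ι : Finset (EuclideanSpace ℝ (Fin 3)) → Literature.Probability.Process.LocalConfig.RootedHardCoreConfig (EuclideanSpace ℝ (Fin 3)) δ, (∀ (ρ : ℝ) (T : Finset (EuclideanSpace ℝ (Fin 3))), Literature.Probability.PointProcesses.IsRootedPattern δ ρ T → ((↑(ι T).1 : Set (EuclideanSpace ℝ (Fin 3)))) = insert (0 : (EuclideanSpace ℝ (Fin 3))) (↑T : Set (EuclideanSpace ℝ (Fin 3)))) → ∀ ℓ : ℝ → (Finset (EuclideanSpace ℝ (Fin 3)) → ℝ) → ℝ,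
      (∀ (ρ : ℝ) (f₁ f₂ : Finset (EuclideanSpace ℝ (Fin 3)) → ℝ), ℓ ρ (f₁ + f₂) = ℓ ρ f₁ + ℓ ρ f₂) →
      (∀ (ρ t : ℝ) (f : Finset (EuclideanSpace ℝ (Fin 3)) → ℝ), ℓ ρ (t • f) = t * ℓ ρ f) →
      (∀ (ρ : ℝ) (f : Finset (EuclideanSpace ℝ (Fin 3)) → ℝ), (∀ S : Finset (EuclideanSpace ℝ (Fin 3)), Literature.Probability.PointProcesses.IsRootedPattern δ ρ S → 0 ≤ f S ∧ f S ≤ 1) → 0 ≤ ℓ ρ f) →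
      (∀ ρ : ℝ, ℓ ρ (fun _ => 1) = 1) →
      (∀ ρ ρ' : ℝ, ρ ≤ ρ' → ∀ f : Finset (EuclideanSpace ℝ (Fin 3)) → ℝ, ℓ ρ' (fun S => f (Literature.Probability.PointProcesses.ballPattern ρ S)) = ℓ ρ f) →
      (∀ η : ℝ, 0 < η → ∃ ρ : ℝ, 1 ≤ ρ ∧ ℓ ρ (fun S => (∑ v ∈ S, Literature.MathematicalPhysics.StatisticalMechanics.lennardJones ‖v‖) / 2) ≤ (⨅ Q : Literature.MathematicalPhysics.StatisticalMechanics.PeriodicConfiguration 3, Q.energyPerParticle Literature.MathematicalPhysics.StatisticalMechanics.lennardJones) + η) →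
      ∀ Q : MeasureTheory.Measure (Literature.Probability.Process.LocalConfig.RootedHardCoreConfig (EuclideanSpace ℝ (Fin 3)) δ), MeasureTheory.IsProbabilityMeasure Q →
      (∀ F : Literature.Probability.Process.LocalConfig.RootedHardCoreConfig (EuclideanSpace ℝ (Fin 3)) δ → ℝ, Continuous F → ∀ c : ℝ, ((∃ n₀ : ℕ, ∀ n : ℕ, n₀ ≤ n → c ≤ ℓ (n : ℝ) (fun T => F (ι T))) → c ≤ ∫ x, F x ∂Q) ∧ ((∃ n₀ : ℕ, ∀ n : ℕ, n₀ ≤ n → ℓ (n : ℝ) (fun T => F (ι T)) ≤ c) → ∫ x, F x ∂Q ≤ c)) →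
      (∫ S, (∫ y, Literature.MathematicalPhysics.StatisticalMechanics.lennardJones ‖y‖ ∂(Literature.Probability.Process.LocalConfig.toMeasure S.1)) / 2 ∂Q) ≤ (⨅ Q : Literature.MathematicalPhysics.StatisticalMechanics.PeriodicConfiguration 3, Q.energyPerParticle Literature.MathematicalPhysics.StatisticalMechanics.lennardJones) := by
  intro δ hδ ι hι ℓ H1 H2 H3 _H4 H5 H7 Q _hQ REPR
  have hFc := continuous_integral_lennardJones_toMeasure (δ := δ) hδ
  have hmain : ∫ S, (∫ y, lennardJones ‖y‖ ∂(toMeasure S.1)) ∂Q ≤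
      2 * ⨅ P : PeriodicConfiguration 3, P.energyPerParticle lennardJones := by
    refine le_of_forall_pos_le_add fun η hη => ?_
    obtain ⟨ρ, hρ1, hρ⟩ := H7 (η / 2) (half_pos hη)
    refine (REPR _ hFc _).2 ⟨⌈ρ⌉₊, fun n hn => ?_⟩
    have hρn : ρ ≤ (n : ℝ) := (Nat.le_ceil ρ).trans (by exact_mod_cast hn)
    have hmono : ℓ n (fun T => ∫ y, lennardJones ‖y‖ ∂(toMeasure (ι T).1)) ≤
        ℓ n (fun T => ∑ v ∈ ballPattern ρ T, lennardJones ‖v‖) :=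
      lawEnergy_mean_le_mean_ballPattern hδ hρ1 (H1 n) (H2 n) (H3 n)
        fun T hT => lawEnergy_integral_eq_sum (ι T) T (hι n T hT)
    have hproj : ℓ n (fun T => ∑ v ∈ ballPattern ρ T, lennardJones ‖v‖) =
        ℓ ρ (fun S => ∑ v ∈ S, lennardJones ‖v‖) :=
      H5 ρ n hρn (fun S => ∑ v ∈ S, lennardJones ‖v‖)
    have hhalf : ℓ ρ (fun S => ∑ v ∈ S, lennardJones ‖v‖) =
        2 * ℓ ρ (fun S => (∑ v ∈ S, lennardJones ‖v‖) / 2) := by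
      rw [← H2]
      congr 1
      funext S
      simp only [Pi.smul_apply, smul_eq_mul]
      ring
    exact hmono.trans (by linarith)
  rw [integral_div]
  linarith

end Summit.AtomisticToContinuum.Crystallization.Theorems.PatternPricedCertificates

end
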